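import Mathlib.LinearAlgebra.Matrix.SchurComplement
import Mathlib.LinearAlgebra.Matrix.Hermitian
import Mathlib.Tactic.LinearCombination
import Summits.Ventures.HodgeRepro2.T5HermitianDetClass

/-!
# Every hermitian matrix is congruent to a diagonal one (cell pub-hodge-repro2, seat p3)

Tier-5 N2 support, row N2.2.2 of route/T5-N2-route-3.md (the NON-split case) and N2.7.1: the classification
of hermitian spaces over a quadratic extension `E/F` (Shimura, Arithmetic of hermitian forms, Doc. Math. 13 (2008),
§1.2 p. 744 and Lemma 1.6 p. 745; Jacobowitz 1962) starts from the diagonalisation «every hermitian form has an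
orthogonal basis, `ϕ ≅ ⟨a₁, …, aₙ⟩` with `aᵢ ∈ F`». Mathlib at the pin has this only for SYMMETRIC BILINEAR forms
(`LinearMap.BilinForm.exists_orthogonal_basis`, characteristic `≠ 2`); this file proves the hermitian version at
the matrix level, over any field `E` with an involution `star` such that **some `μ` has `μ + star μ ≠ 0`** —
which holds whenever the involution is non-trivial (any characteristic) and whenever `2 ≠ 0` (any involution):

* `exists_isCongruent_diag_ne_zero`: a non-zero hermitian `H` is congruent to one with a non-zero diagonal entry
  (a unipotent congruence `P = 1 + c·E_{ji}` realises `μ + star μ` on the diagonal);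
* `isCongruent_fromBlocks_schur`: one LDLᴴ step, `fromBlocks A B Bᴴ D ≅ fromBlocks A 0 0 (D − Bᴴ A⁻¹ B)`;
* **`exists_congruent_diagonal`**: every hermitian `H` is congruent (`IsCongruent` of file 134) to `diagonal d`
  with every `d i` star-fixed; `exists_congruent_diagonal_ne_zero`: invertible `H` ⟹ all `d i ≠ 0`.

With file 134 (`d₀` a congruence invariant) this is the full ELEMENTARY part of Lemma 1.6: «`dim` and the class
of `d₀ = (−1)^{n(n−1)/2} ∏ aᵢ` in `F^×/N(E^×)` are invariants, and every form is diagonal». What stays print is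
the «if» half (same `dim` and `d₀` ⟹ isomorphic), whose proof needs the local fact that a binary hermitian form
represents every element of `F^×` (Jacobowitz; O'Meara 63:13a's index formula). Mathlib + file 134 only.
No display; no device. §8(d): uses an L-value-free non-vanishing device: NO.
-/

namespace Summit.Ventures.HodgeRepro2.T5HermitianDiagonalize

open Matrix
open Summit.Ventures.HodgeRepro2.T5HermitianDetClass

section Scalars

variable {E : Type*} [Field E] [StarRing E]

/-- A non-trivial involution supplies `μ` with `μ + star μ ≠ 0`: `μ = 1` if `2 ≠ 0`, else the `λ` with
`star λ ≠ λ` (in characteristic `2`, `λ + star λ = λ − star λ ≠ 0`). -/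
theorem exists_add_star_ne_zero_of_star_ne (h : ∃ l : E, star l ≠ l) : ∃ μ : E, μ + star μ ≠ 0 := by
  by_cases h2 : (2 : E) = 0
  · obtain ⟨l, hl⟩ := h
    refine ⟨l, fun hc => hl ?_⟩
    have : star l = -l := by linear_combination hc
    rw [this, neg_eq_iff_add_eq_zero]
    linear_combination l * h2
  · exact ⟨1, by rw [star_one]; exact fun hc => h2 (by linear_combination hc)⟩

/-- In characteristic `≠ 2`, `μ = 1` works for any involution. -/
theorem exists_add_star_ne_zero_of_two_ne_zero (h2 : (2 : E) ≠ 0) : ∃ μ : E, μ + star μ ≠ 0 :=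
  ⟨1, by rw [star_one]; exact fun hc => h2 (by linear_combination hc)⟩

end Scalars

section FormValue

variable {E : Type*} [Field E] [StarRing E] {ι : Type*} [Fintype ι] [DecidableEq ι]

/-- The value `h(w, w) = star w ⬝ᵥ H w` of the form with Gram matrix `H` on the vector `w`. -/
def formVal (H : Matrix ι ι E) (w : ι → E) : E := star w ⬝ᵥ (H *ᵥ w)

omit [DecidableEq ι] in
/-- The diagonal entries of `Pᴴ H P` are the values of the form on the columns of `P`. -/
theorem conjTranspose_mul_mul_apply_self (P H : Matrix ι ι E) (i : ι) :
    (Pᴴ * H * P) i i = formVal H (Pᵀ i) := by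
  rw [mul_mul_apply]
  rfl

omit [StarRing E] in
/-- `(H eⱼ x)ₖ = H k j * x`. -/
theorem mulVec_single_apply (H : Matrix ι ι E) (j k : ι) (x : E) :
    (H *ᵥ Pi.single j x) k = H k j * x := by
  simp [Matrix.mulVec, dotProduct_single]

/-- `h(eᵢ, eᵢ) = H i i`. -/
theorem formVal_single (H : Matrix ι ι E) (i : ι) : formVal H (Pi.single i 1) = H i i := by
  unfold formVal
  rw [← Pi.single_star, star_one, single_dotProduct, one_mul, mulVec_single_apply, mul_one]

/-- `h(eᵢ + c eⱼ, eᵢ + c eⱼ) = H i i + c H i j + star c H j i + star c c H j j`. -/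
theorem formVal_single_add_single (H : Matrix ι ι E) (i j : ι) (c : E) :
    formVal H (Pi.single i 1 + Pi.single j c) =
      H i i + c * H i j + star c * H j i + star c * c * H j j := by
  unfold formVal
  rw [star_add, ← Pi.single_star, ← Pi.single_star, star_one, mulVec_add, add_dotProduct, dotProduct_add,
    dotProduct_add, single_dotProduct, single_dotProduct, single_dotProduct, single_dotProduct,
    mulVec_single_apply, mulVec_single_apply, mulVec_single_apply, mulVec_single_apply]
  ring

end FormValue

section Anisotropic

variable {E : Type*} [Field E] [StarRing E] {ι : Type*} [Fintype ι] [DecidableEq ι]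

/-- The unipotent matrix `1 + c·E_{j i}` (column `i` gets `c` in row `j`). -/
def unip (i j : ι) (c : E) : Matrix ι ι E := 1 + vecMulVec (Pi.single j c) (Pi.single i 1)

omit [StarRing E] in
/-- `det (1 + c·E_{j i}) = 1` for `i ≠ j`. -/
theorem det_unip {i j : ι} (hij : i ≠ j) (c : E) : (unip i j c).det = 1 := by
  unfold unip
  rw [vecMulVec_eq Unit, det_one_add_replicateCol_mul_replicateRow, single_dotProduct, one_mul,
    Pi.single_eq_of_ne hij, add_zero]

omit [StarRing E] [Fintype ι] in
/-- Column `i` of `1 + c·E_{j i}` is `eᵢ + c eⱼ`. -/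
theorem unip_transpose_apply (i j : ι) (c : E) :
    (unip i j c)ᵀ i = Pi.single i 1 + Pi.single j c := by
  ext k
  simp [unip, Matrix.one_apply, vecMulVec_apply, Pi.single_apply]

/-- **A non-zero hermitian matrix is congruent to one with a non-zero diagonal entry** (given some `μ` with
`μ + star μ ≠ 0`): if some `H i i ≠ 0` nothing is to do; otherwise pick `H i j ≠ 0` and use the unipotent
congruence `1 + (μ / H i j)·E_{j i}`, whose `(i, i)`-entry is `μ + star μ`. -/
theorem exists_isCongruent_diag_ne_zero (hμ : ∃ μ : E, μ + star μ ≠ 0) {H : Matrix ι ι E}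
    (hH : H.IsHermitian) (h0 : H ≠ 0) : ∃ H₁ : Matrix ι ι E, ∃ i : ι, IsCongruent H H₁ ∧ H₁ i i ≠ 0 := by
  by_cases hdiag : ∃ i, H i i ≠ 0
  · obtain ⟨i, hi⟩ := hdiag
    exact ⟨H, i, isCongruent_refl H, hi⟩
  · have hdiag' : ∀ i, H i i = 0 := fun i => by
      by_contra h
      exact hdiag ⟨i, h⟩
    have hoff : ∃ i j, H i j ≠ 0 := by
      by_contra hc
      apply h0
      ext i j
      by_contra h
      exact hc ⟨i, j, h⟩
    obtain ⟨i, j, hij⟩ := hoff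
    have hne : i ≠ j := fun h => hij (h ▸ hdiag' i)
    obtain ⟨μ, hμ⟩ := hμ
    refine ⟨(unip i j (μ / H i j))ᴴ * H * unip i j (μ / H i j), i, ?_, ?_⟩
    · refine ⟨unip i j (μ / H i j), ?_, rfl⟩
      rw [det_unip hne]
      exact isUnit_one
    · rw [conjTranspose_mul_mul_apply_self, unip_transpose_apply, formVal_single_add_single, hdiag' i,
        hdiag' j, ← hH.apply j i, div_mul_cancel₀ μ hij, ← star_mul', div_mul_cancel₀ μ hij]
      simpa using hμ

end Anisotropic

section Schur

variable {E : Type*} [Field E] [StarRing E] {m n : Type*} [Fintype m] [Fintype n] [DecidableEq m]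
  [DecidableEq n]

/-- **One LDLᴴ step**: for a hermitian block matrix with invertible top-left block `A`,
`fromBlocks A B Bᴴ D ≅ fromBlocks A 0 0 (D − Bᴴ A⁻¹ B)`. Mathlib's `fromBlocks_eq_of_invertible₁₁` writes
`fromBlocks A B Bᴴ D = L · Δ · U` with `U = fromBlocks 1 (A⁻¹ B) 0 1`; for hermitian input `L = Uᴴ`, so
`P = U⁻¹` is the congruence. -/
theorem isCongruent_fromBlocks_schur (A : Matrix m m E) (B : Matrix m n E) (D : Matrix n n E)
    (hA : A.IsHermitian) (hAdet : IsUnit A.det) :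
    IsCongruent (fromBlocks A B Bᴴ D) (fromBlocks A 0 0 (D - Bᴴ * A⁻¹ * B)) := by
  letI : Invertible A := invertibleOfIsUnitDet A hAdet
  have hAinv : (⅟A)ᴴ = ⅟A := by rw [invOf_eq_nonsing_inv, conjTranspose_nonsing_inv, hA.eq]
  obtain ⟨U, hU⟩ : ∃ U : Matrix (m ⊕ n) (m ⊕ n) E, U = fromBlocks 1 (⅟A * B) 0 1 := ⟨_, rfl⟩
  have hUdet : IsUnit U.det := by
    rw [hU, det_fromBlocks_zero₂₁, det_one, det_one, one_mul]
    exact isUnit_one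
  have hUH : IsUnit Uᴴ.det := by
    rw [det_conjTranspose]
    exact isUnit_star.mpr hUdet
  have hL : fromBlocks 1 0 (Bᴴ * ⅟A) 1 = Uᴴ := by
    rw [hU, fromBlocks_conjTranspose, conjTranspose_one, conjTranspose_one, conjTranspose_zero,
      conjTranspose_mul, hAinv]
  refine ⟨U⁻¹, isUnit_nonsing_inv_det U hUdet, ?_⟩
  rw [fromBlocks_eq_of_invertible₁₁ A B Bᴴ D, hL, ← hU, conjTranspose_nonsing_inv,
    Matrix.mul_assoc Uᴴ, nonsing_inv_mul_cancel_left _ _ hUH, mul_nonsing_inv_cancel_right _ _ hUdet,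
    invOf_eq_nonsing_inv]

/-- Congruence is transported along an equivalence of index types. -/
theorem isCongruent_submatrix {ι κ : Type*} [Fintype ι] [DecidableEq ι] [Fintype κ] [DecidableEq κ]
    {H H' : Matrix ι ι E} (h : IsCongruent H H') (e : κ ≃ ι) :
    IsCongruent (H.submatrix e e) (H'.submatrix e e) := by
  obtain ⟨P, hP, rfl⟩ := h
  refine ⟨P.submatrix e e, ?_, ?_⟩
  · rw [det_submatrix_equiv_self]
    exact hP
  · rw [conjTranspose_submatrix, submatrix_mul_equiv, submatrix_mul_equiv]

/-- Block-diagonal congruence on the second block. -/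
theorem isCongruent_fromBlocks_of_isCongruent (A : Matrix m m E) {D D' : Matrix n n E}
    (h : IsCongruent D D') : IsCongruent (fromBlocks A 0 0 D) (fromBlocks A 0 0 D') := by
  obtain ⟨P, hP, rfl⟩ := h
  refine ⟨fromBlocks 1 0 0 P, ?_, ?_⟩
  · rw [det_fromBlocks_zero₂₁, det_one, one_mul]
    exact hP
  · rw [fromBlocks_conjTranspose, fromBlocks_multiply, fromBlocks_multiply]
    simp only [conjTranspose_one, conjTranspose_zero, Matrix.one_mul, Matrix.mul_one, Matrix.zero_mul,
      Matrix.mul_zero, add_zero, zero_add]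

end Schur

section Induction

variable {E : Type*} [Field E] [StarRing E]

omit [StarRing E] in
/-- A `1 × 1` matrix (on a `Unique` index type) is diagonal. -/
theorem eq_diagonal_of_unique {ι : Type*} [Unique ι] [DecidableEq ι] (A : Matrix ι ι E) :
    A = diagonal (fun i => A i i) := by
  ext i j
  rw [Subsingleton.elim j i, diagonal_apply_eq]

/-- The induction on the size: every hermitian `H` on an index type of cardinality `k` is congruent to a
diagonal matrix. -/
theorem exists_congruent_diagonal_of_card (hμ : ∃ μ : E, μ + star μ ≠ 0) :
    ∀ (k : ℕ) {ι : Type*} [Fintype ι] [DecidableEq ι], Fintype.card ι = k →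
      ∀ H : Matrix ι ι E, H.IsHermitian → ∃ d : ι → E, IsCongruent H (diagonal d) := by
  intro k
  induction k with
  | zero =>
    intro ι _ _ hk H _
    haveI : IsEmpty ι := Fintype.card_eq_zero_iff.mp hk
    refine ⟨fun i => H i i, ?_⟩
    have : H = diagonal fun i => H i i := by
      ext i j
      exact (IsEmpty.false i).elim
    rw [← this]
    exact isCongruent_refl H
  | succ k ih =>
    intro ι _ _ hk H hH
    by_cases h0 : H = 0
    · refine ⟨fun _ => 0, ?_⟩
      rw [h0, diagonal_zero]
      exact isCongruent_refl 0
    obtain ⟨H₁, i₀, hc, hne⟩ := exists_isCongruent_diag_ne_zero hμ hH h0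
    have hH₁ : H₁.IsHermitian := hc.isHermitian hH
    -- split the index type as `{i // i = i₀} ⊕ {i // ¬ i = i₀}`
    obtain ⟨e, he⟩ : ∃ e : { i : ι // i = i₀ } ⊕ { i : ι // ¬ i = i₀ } ≃ ι,
        e = Equiv.sumCompl (fun i => i = i₀) := ⟨_, rfl⟩
    obtain ⟨M, hMdef⟩ : ∃ M : Matrix _ _ E, M = H₁.submatrix e e := ⟨_, rfl⟩
    have hM : M.IsHermitian := by
      rw [hMdef]
      exact (isHermitian_submatrix_equiv e).mpr hH₁
    have hM' : (fromBlocks M.toBlocks₁₁ M.toBlocks₁₂ M.toBlocks₂₁ M.toBlocks₂₂).IsHermitian := by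
      rw [fromBlocks_toBlocks]
      exact hM
    obtain ⟨hA, hBC, -, -⟩ := isHermitian_fromBlocks_iff.mp hM'
    -- the top-left block is the `1 × 1` matrix `(H₁ i₀ i₀)`
    have hAdet : IsUnit M.toBlocks₁₁.det := by
      rw [det_unique, isUnit_iff_ne_zero]
      have : M.toBlocks₁₁ default default = H₁ i₀ i₀ := by
        rw [hMdef, he]
        rfl
      rw [this]
      exact hne
    -- the Schur step
    have hschur := isCongruent_fromBlocks_schur M.toBlocks₁₁ M.toBlocks₁₂ M.toBlocks₂₂ hA hAdet
    rw [hBC, fromBlocks_toBlocks] at hschur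
    -- the Schur complement is hermitian
    have hS := (isHermitian_fromBlocks_iff.mp (hschur.isHermitian hM)).2.2.2
    -- induction hypothesis on the complement
    have hcard : Fintype.card { i : ι // ¬ i = i₀ } = k := by
      rw [Fintype.card_subtype_compl, Fintype.card_subtype_eq, hk, Nat.add_sub_cancel]
    obtain ⟨d', hd'⟩ := ih hcard _ hS
    -- assemble
    have h1 := isCongruent_fromBlocks_of_isCongruent M.toBlocks₁₁ hd'
    have hfb : fromBlocks M.toBlocks₁₁ (0 : Matrix _ _ E) 0 (diagonal d') =
        diagonal (Sum.elim (fun i => M.toBlocks₁₁ i i) d') := by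
      rw [← fromBlocks_diagonal]
      congr 1
      exact eq_diagonal_of_unique _
    rw [hfb] at h1
    have h3 := isCongruent_submatrix (hschur.trans h1) e.symm
    have hMe : M.submatrix e.symm e.symm = H₁ := by
      rw [hMdef, submatrix_submatrix, Equiv.self_comp_symm, submatrix_id_id]
    rw [hMe, submatrix_diagonal_equiv] at h3
    exact ⟨_, hc.trans h3⟩

/-- **Diagonalisation of hermitian matrices.** Over a field `E` with an involution such that some `μ` has
`μ + star μ ≠ 0` (any non-trivial involution; any involution in characteristic `≠ 2`), every hermitian matrix
is congruent to a diagonal matrix whose entries are star-fixed. -/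
theorem exists_congruent_diagonal (hμ : ∃ μ : E, μ + star μ ≠ 0) {ι : Type*} [Fintype ι] [DecidableEq ι]
    (H : Matrix ι ι E) (hH : H.IsHermitian) :
    ∃ d : ι → E, (∀ i, star (d i) = d i) ∧ IsCongruent H (diagonal d) := by
  obtain ⟨d, hd⟩ := exists_congruent_diagonal_of_card hμ _ rfl H hH
  refine ⟨d, fun i => ?_, hd⟩
  have := (isHermitian_diagonal_iff).mp (hd.isHermitian hH) i
  exact this.star_eq

/-- For an invertible hermitian matrix the diagonal entries are all non-zero. -/
theorem exists_congruent_diagonal_ne_zero (hμ : ∃ μ : E, μ + star μ ≠ 0) {ι : Type*} [Fintype ι]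
    [DecidableEq ι] (H : Matrix ι ι E) (hH : H.IsHermitian) (hdet : IsUnit H.det) :
    ∃ d : ι → E, (∀ i, star (d i) = d i) ∧ (∀ i, d i ≠ 0) ∧ IsCongruent H (diagonal d) := by
  obtain ⟨d, hd, hc⟩ := exists_congruent_diagonal hμ H hH
  refine ⟨d, hd, fun i => ?_, hc⟩
  have : IsUnit (diagonal d).det := hc.isUnit_det_iff.mp hdet
  rw [det_diagonal, isUnit_iff_ne_zero, Finset.prod_ne_zero_iff] at this
  exact this i (Finset.mem_univ i)

/-- The same for a NON-TRIVIAL involution (no hypothesis on the characteristic). -/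
theorem exists_congruent_diagonal_of_star_ne (h : ∃ l : E, star l ≠ l) {ι : Type*} [Fintype ι]
    [DecidableEq ι] (H : Matrix ι ι E) (hH : H.IsHermitian) :
    ∃ d : ι → E, (∀ i, star (d i) = d i) ∧ IsCongruent H (diagonal d) :=
  exists_congruent_diagonal (exists_add_star_ne_zero_of_star_ne h) H hH

end Induction

end Summit.Ventures.HodgeRepro2.T5HermitianDiagonalize
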